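import Summits.AnomalousDissipation.AnomalousDissipation.Theorems.SawtoothPulseCascadeK1LocalisedCascadeHalfStepV
import Summits.AnomalousDissipation.AnomalousDissipation.Theorems.SawtoothPulseCascadeK1LocalisedCascadeEnvelopeAmplitude

/-!
# K1loc, line `Spectral` / thin start — helper: THE V HALF-STEP WITH THE TWIST CUT-OFF (amplitude form, modular constants)

Helper file of the prover lane on the crux `K1LocalisedCascade` (stmt-AnomalousDissipation-19491), route
`SawtoothPulseCascade` (S-D fibre ledger; memo v9 §9).  Second form of the V half-step window inequality
`…HalfStepV.sum_window_sq_norm_vstep_le`, with three changes that carry the constants: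
* the mid-band multiplier is the cut-off of the TWIST itself, `g^mid_n = ψ_n ⋆ g_n` (not `ψ_n ⋆ g₀ⁿ + (g_n − g₀ⁿ)`), so that
  `|g^mid_n| ≤ ‖k_{ψ_n}‖₁ =: A` everywhere — no `+2` from the rounding remainder, which is now averaged against the kernel
  (`norm_integral_mul_le_of_near_far`) and only felt `Mδ_j/(πN_j)`-close to the corners;
* the kernel bounds enter as HYPOTHESES (`∫|k_{ψ_n}| ≤ A`, tails `∫_{δ≤‖s‖}|k_{ψ_n}| ≤ τ/δ`), so that any kernel estimate
  (`…TrapezoidFejer`, sharper closed forms) can be plugged in;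
* the zone term is in AMPLITUDE form with the exact decay mass: `√(∫ρ²) ≤ ε₀ + A·√(|C_N|·4d₀)` (`…EnvelopeAmplitude`).
**`sum_window_sq_norm_vstep_twist_le`** —
`Σ_{k∈W}‖𝓕(b∘Φ_V)(k)‖² ≤ ((∫|k_χ|)·(ε₀ + A·√(2N_j·4d₀)) + √(Σ_{n∈F}∫‖A¹_n(b − T_χ b)‖²))²`
under `8τ ≤ A·d₀`, `Mδ_j < πN_j d₀`, `ε₀ ≥ A·π|nγ|e^{−M²/2}/N_j` on the fibres of `W`.
No definitions; no statement about the crux. [cite: Grafakos2014, Prop. 3.1.2 (5), §3.1.3]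
[cite: ElgindiLissMattingly2025, §1 (slope ±1 branches)] [problem: turb]
-/

-- `Summit.<Summit>.<Problem>`: single-conjunct summit, the duplicate namespace segment is deliberate.
set_option linter.dupNamespace false

noncomputable section

namespace Summit.AnomalousDissipation.AnomalousDissipation.Theorems.SawtoothPulseCascade.K1Window

open MeasureTheory Set Filter Topology UnitAddTorus Function Complex Metric
open scoped Real ENNReal
open Literature.Analysis Literature.Analysis.FunctionSpaces Literature.Analysis.FunctionSpaces.Torus Literature.Analysis.FluidPDE
open Literature.Analysis.FluidPDE.ShearStage
open Literature.Analysis.FluidPDE.SawtoothCascade Literature.Analysis.FluidPDE.SawtoothCascade.CascadeParams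
open Summit.AnomalousDissipation.AnomalousDissipation.Theorems.SawtoothPulseCascade.K1Start
open Summit.AnomalousDissipation.AnomalousDissipation.Theorems.SawtoothPulseCascade.K1Flat

/-! ## The V half-step with the twist cut-off -/

/-- **THE V HALF-STEP, TWIST CUT-OFF FORM** (see the file header).  Data as in `…HalfStepV.sum_window_sq_norm_vstep_le`
(integer strain `γ = G`, input cut-off `χ` supported in `|l| < L` with `|χ| ≤ 1`, per-fibre symbols `ψ_n` supported in `Sψ n`
with `ψ_n(±nG) = 0` and plateau `ψ_n(k₀ − l) = 1`, `k ∈ W`, `|l| < L`), kernel constants `A ≥ ∫|k_{ψ_n}|`, `τ` with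
`∫_{δ≤‖s‖}|k_{ψ_n}| ≤ τ/δ`, envelope scale `d₀` with `8τ ≤ A d₀` and `Mδ_j < πN_j d₀`, and `ε₀ ≥ A·2π|nG|e^{−M²/2}/(2N_j)`.
[cite: Grafakos2014, Prop. 3.1.2 (5), §3.1.3] -/
theorem sum_window_sq_norm_vstep_twist_le (P : CascadeParams) {G : ℕ} (hγ : P.γ = G) (hδ₀ : 0 < P.δ₀) (hd : 0 < P.d)
    (hN₀ : 1 ≤ P.N₀) (hρN : 1 ≤ P.ρN) (j : ℕ)
    {b : UnitAddTorus (Fin 2) → ℂ} (hb : Continuous b) (hbs : Summable fun k => ‖mFourierCoeff b k‖) (hb1 : ∀ x, ‖b x‖ ≤ 1)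
    (W : Finset (Fin 2 → ℤ)) (χ : ℤ → ℂ) (Sχ : Finset ℤ) (hχS : ∀ l, l ∉ Sχ → χ l = 0) (hχ1 : ∀ l, ‖χ l‖ ≤ 1)
    (L : ℕ) (hχL : ∀ l, χ l ≠ 0 → |l| < L) (ψ : ℤ → ℤ → ℂ) (Sψ : ℤ → Finset ℤ)
    (hψS : ∀ n m, m ∉ Sψ n → ψ n m = 0)
    (hψ0 : ∀ k ∈ W, ψ (k 1) (k 1 * G) = 0 ∧ ψ (k 1) (-(k 1 * G)) = 0)
    (hψ1 : ∀ k ∈ W, ∀ l : ℤ, |l| < L → ψ (k 1) (k 0 - l) = 1)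
    {d₀ M ε₀ A τ : ℝ} (hd₀ : 0 < d₀) (hM : 1 ≤ M) (hMδ : M * P.δ j < π / 2) (hMd : M * P.δ j < π * P.N j * d₀)
    (hA0 : 0 ≤ A) (hA : ∀ k ∈ W, (∫ s : UnitAddCircle, ‖∑ m ∈ Sψ (k 1), ψ (k 1) m * fourier (-m) s‖) ≤ A)
    (hτ : ∀ k ∈ W, ∀ δ : ℝ, 0 < δ →
      ∫ s in {s : UnitAddCircle | δ ≤ ‖s‖}, ‖∑ m ∈ Sψ (k 1), ψ (k 1) m * fourier (-m) s‖ ≤ τ / δ)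
    (hAd : 8 * τ ≤ A * d₀) (hε0 : 0 ≤ ε₀)
    (hε : ∀ k ∈ W, A * (2 * π * |((k 1 * G : ℤ) : ℝ)| * (Real.exp (-(M ^ 2 / 2)) / (2 * P.N j))) ≤ ε₀) :
    ∑ k ∈ W, ‖mFourierCoeff (b ∘ shearMap 1 0 (amp ⟨P.U j, P.U_periodic j, P.contDiff_U (P.δ_pos hδ₀ hd j)⟩ P.γ)) k‖ ^ 2 ≤
      ((∫ s : UnitAddCircle, ‖∑ l ∈ Sχ, χ l * fourier (-l) s‖) *
          (ε₀ + A * Real.sqrt ((2 * P.N j : ℕ) * (4 * d₀))) +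
        Real.sqrt (∑ n ∈ W.image (fun k => k 1), ∫ x : UnitAddTorus (Fin 2),
          ‖∫ s : UnitAddCircle, (fourier (-n) s : ℂ) •
            (b (x + Pi.single (1 : Fin 2) s) - ∑ l ∈ Sχ, χ l * ∫ s' : UnitAddCircle,
              (fourier (-l) s' : ℂ) • b (x + Pi.single (1 : Fin 2) s + Pi.single (0 : Fin 2) s'))‖ ^ 2)) ^ 2 := by
  classical
  have h10 : (1 : Fin 2) ≠ 0 := by decide
  have hπ : 0 < π := Real.pi_pos
  have hN : P.N j ≠ 0 := (N_pos P hN₀ hρN j).ne'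
  have hNpos : 0 < P.N j := Nat.pos_of_ne_zero hN
  have hNr : (0 : ℝ) < P.N j := by exact_mod_cast hNpos
  have hc : 0 < 2 * π * (P.N j : ℝ) := by positivity
  have hI : ∀ {f : UnitAddCircle → ℂ}, Continuous f → Integrable f := fun hf =>
    hf.integrable_of_hasCompactSupport (HasCompactSupport.of_compactSpace _)
  set Ψ : ShearProfile := amp ⟨P.U j, P.U_periodic j, P.contDiff_U (P.δ_pos hδ₀ hd j)⟩ P.γ with hΨ
  have hΨt : ∀ t : ℝ, Ψ t = P.γ * P.U j t := fun t => amp_apply _ _ _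
  -- the input cut-off and its complement
  set T : UnitAddTorus (Fin 2) → ℂ := fun x => ∑ l ∈ Sχ, χ l *
    ∫ s : UnitAddCircle, (fourier (-l) s : ℂ) • b (x + Pi.single (0 : Fin 2) s) with hT
  have hTc : Continuous T := continuous_finsetSum _ fun l _ => continuous_const.mul (continuous_twistedAxisAvg hb 0 l)
  have hTcoef : ∀ k, mFourierCoeff T k = χ (k 0) * mFourierCoeff b k := fun k => mFourierCoeff_axisCutoff hb 0 hχS k
  have hTs : Summable fun k => ‖mFourierCoeff T k‖ := by
    refine Summable.of_nonneg_of_le (fun k => norm_nonneg _) (fun k => ?_) hbs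
    rw [hTcoef k, norm_mul]
    exact mul_le_of_le_one_left (norm_nonneg _) (hχ1 _)
  set θ₂ : UnitAddTorus (Fin 2) → ℂ := fun x => b x - T x with hθ₂
  have hθ₂c : Continuous θ₂ := hb.sub hTc
  have hsum : (fun x => T x + θ₂ x) = b := by funext x; simp [hθ₂]
  -- the exact chirps, the circle kernels, the twist cut-off
  set g0 : ℤ → UnitAddCircle → ℂ := fun n => (periodic_exactChirpFun (P.N j) (n * G)).lift with hg0
  have hg0c : ∀ n, Continuous (g0 n) := fun n => (continuous_exactChirp_lift (P.N j) (n * G)).1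
  have hg0t : ∀ n (t : ℝ), g0 n (t : UnitAddCircle) =
      Complex.exp (-(2 * π * I * ((n * G : ℤ)) * ((tri (2 * π * P.N j * t) / (2 * π * P.N j) : ℝ) : ℂ))) :=
    fun n t => (continuous_exactChirp_lift (P.N j) (n * G)).2 t
  have hg01 : ∀ n bb, ‖g0 n bb‖ ≤ 1 := by
    intro n bb
    obtain ⟨t, rfl⟩ := QuotientAddGroup.mk_surjective bb
    rw [hg0t]; exact norm_exp_chirp_le _ _
  have htw1 : ∀ n bb, ‖twist Ψ n bb‖ ≤ 1 := fun n bb => (norm_twist Ψ n bb).le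
  set kψ : ℤ → UnitAddCircle → ℂ := fun n s => ∑ m ∈ Sψ n, ψ n m * fourier (-m) s with hkψ
  have hkψc : ∀ n, Continuous (kψ n) := fun n =>
    continuous_finsetSum _ fun m _ => continuous_const.mul (fourier (-m)).continuous
  set gmid : ℤ → UnitAddCircle → ℂ := fun n bb => ∫ s : UnitAddCircle, kψ n s * twist Ψ n (bb + s) with hgmid
  set grest : ℤ → UnitAddCircle → ℂ := fun n bb => twist Ψ n bb - ∫ s : UnitAddCircle, kψ n s * twist Ψ n (bb + s)
    with hgrest
  have hgmidc : ∀ n, Continuous (gmid n) := fun n => continuous_circleCutoff (hkψc n) (continuous_twist Ψ n)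
  have hgrestc : ∀ n, Continuous (grest n) := fun n =>
    (continuous_twist Ψ n).sub (continuous_circleCutoff (hkψc n) (continuous_twist Ψ n))
  have hsplit : ∀ k ∈ W, ∀ bb, twist Ψ (k 1) bb = gmid (k 1) bb + grest (k 1) bb := by
    intro k _ bb; simp only [hgmid, hgrest]; ring
  -- exact separation
  have hsep : ∀ k ∈ W, ∀ m : ℤ, fourierCoeff (grest (k 1)) m * mFourierCoeff T (k - Pi.single 0 m) = 0 := by
    intro k hk m
    rw [hTcoef]
    have e0 : (k - Pi.single (0 : Fin 2) m : Fin 2 → ℤ) 0 = k 0 - m := by simp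
    rw [e0]
    by_cases hχ0 : χ (k 0 - m) = 0
    · rw [hχ0, zero_mul, mul_zero]
    · have hl : |k 0 - m| < L := hχL _ hχ0
      have hψm : ψ (k 1) m = 1 := by
        have := hψ1 k hk (k 0 - m) hl
        rwa [show k 0 - (k 0 - m) = m by ring] at this
      have hcoef : fourierCoeff (grest (k 1)) m = 0 := by
        simp only [hgrest]
        rw [fourierCoeff_sub_of_continuous (continuous_twist Ψ _)
            (continuous_circleCutoff (hkψc _) (continuous_twist Ψ _)),
          show (fun y : UnitAddCircle => ∫ s : UnitAddCircle, kψ (k 1) s * twist Ψ (k 1) (y + s)) =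
            (fun y : UnitAddCircle => ∫ s : UnitAddCircle, (∑ m' ∈ Sψ (k 1), ψ (k 1) m' * fourier (-m') s) *
              twist Ψ (k 1) (y + s)) from rfl,
          fourierCoeff_circleCutoff (continuous_twist Ψ _) (hψS (k 1)) m, hψm, one_mul, sub_self]
      rw [hcoef, zero_mul]
  -- the corner set, the majorant
  set CF : Finset UnitAddCircle := (Finset.Ico (0 : ℤ) (2 * P.N j)).image
      fun l : ℤ => (((2 * (l : ℝ) + 1) / (4 * P.N j) : ℝ) : UnitAddCircle) with hCF
  have hCFne : CF.Nonempty :=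
    Finset.Nonempty.image ⟨0, Finset.mem_Ico.mpr ⟨le_rfl, by exact_mod_cast (by omega : 0 < 2 * P.N j)⟩⟩ _
  have hCFcard : (CF.card : ℝ) ≤ (2 * P.N j : ℕ) := by
    have h1 : CF.card ≤ (Finset.Ico (0 : ℤ) (2 * P.N j)).card := Finset.card_image_le
    rw [Int.card_Ico] at h1
    exact_mod_cast (by omega : CF.card ≤ 2 * P.N j)
  set C : Set UnitAddCircle := (CF : Set UnitAddCircle) with hC
  set ρ : UnitAddCircle → ℝ := fun bb => ε₀ + A * (d₀ / max (infDist bb C) d₀) with hρ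
  obtain ⟨hρc, hρ0, hρcore, hρoff⟩ := envelope_facts C hε0 hA0 hd₀
  -- the rounding remainder off the `Mδ`-zone
  have hround : ∀ k ∈ W, ∀ u : ℝ, (∀ m : ℤ, M * P.δ j < |2 * π * P.N j * u - (π / 2 + π * m)|) →
      ‖twist Ψ (k 1) ((u : ℝ) : UnitAddCircle) - g0 (k 1) (u : UnitAddCircle)‖ ≤
        2 * π * |((k 1 * G : ℤ) : ℝ)| * (Real.exp (-(M ^ 2 / 2)) / (2 * P.N j)) := by
    intro k hk u hfar2
    have hU := abs_U_sub_tri_le_of_far P hδ₀ hd hN₀ hρN hM hMδ hfar2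
    rw [twist_coe, hΨt, hγ, hg0t]
    have e1 : -(2 * ↑π * I * ((k 1 : ℤ) : ℂ) * (((G : ℝ) * P.U j u : ℝ) : ℂ)) =
        -(2 * π * I * (((k 1 * G : ℤ) : ℝ) : ℂ) * ((P.U j u : ℝ) : ℂ)) := by push_cast; ring
    have e2 : -(2 * ↑π * I * ((k 1 * G : ℤ) : ℂ) * ((tri (2 * π * P.N j * u) / (2 * π * P.N j) : ℝ) : ℂ)) =
        -(2 * π * I * (((k 1 * G : ℤ) : ℝ) : ℂ) * ((tri (2 * π * P.N j * u) / (2 * π * P.N j) : ℝ) : ℂ)) := by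
      push_cast; ring
    rw [e1, e2]
    refine (norm_exp_chirp_sub_le _ _ _).trans ?_
    exact mul_le_mul_of_nonneg_left hU (by positivity)
  have hbd : ∀ k ∈ W, ∀ bb, ‖gmid (k 1) bb‖ ≤ ρ bb := by
    intro k hk bb
    have hkA := hA k hk
    have hkψ1 : (∫ s : UnitAddCircle, ‖kψ (k 1) s‖) ≤ A := by simpa only [hkψ] using hkA
    -- the bound `A`, valid everywhere
    have hcrude : ‖gmid (k 1) bb‖ ≤ A := by
      have h1 : ‖∫ s : UnitAddCircle, kψ (k 1) s * twist Ψ (k 1) (bb + s)‖ ≤ (∫ s : UnitAddCircle, ‖kψ (k 1) s‖) * 1 :=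
        norm_circleCutoff_le (hkψc _) (continuous_twist Ψ _) (htw1 _) bb
      simp only [hgmid]
      linarith
    by_cases hcore : infDist bb C ≤ d₀
    · simp only [hρ]
      rw [hρcore bb hcore]
      linarith [hcrude]
    · -- off the core: `ψ⋆g = ψ⋆g₀ + ψ⋆(g − g₀)`; orthogonality + kernel tail for the first, near/far averaging for the second
      push Not at hcore
      have hdpos : 0 < infDist bb C := hd₀.trans hcore
      obtain ⟨t, rfl⟩ := QuotientAddGroup.mk_surjective bb
      set Id : ℝ := infDist ((t : ℝ) : UnitAddCircle) C with hId
      have hfar := phase_far_of_le_infDist hNpos (le_refl Id)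
      have hfar1 : ∀ m : ℤ, π * P.N j * Id < |2 * π * P.N j * t - (π / 2 + π * m)| :=
        fun m => lt_of_lt_of_le (by nlinarith [mul_pos (mul_pos hπ hNr) hdpos]) (hfar m)
      -- first piece
      have h1 := norm_circleCutoff_exactChirp_le hNpos (hg0c (k 1)) (hg0t (k 1)) (Sψ (k 1)) (hψ0 k hk).1 (hψ0 k hk).2 hfar1
      have hr : π * ↑(P.N j) * Id / (2 * π * ↑(P.N j)) = Id / 2 := by field_simp
      rw [hr] at h1
      have htail : ∫ s in {s : UnitAddCircle | Id / 2 ≤ ‖s‖}, ‖kψ (k 1) s‖ ≤ τ / (Id / 2) := by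
        simpa only [hkψ] using hτ k hk (Id / 2) (by positivity)
      have h1' : ‖∫ s : UnitAddCircle, kψ (k 1) s * g0 (k 1) ((t : UnitAddCircle) + s)‖ ≤ 2 * (τ / (Id / 2)) := by
        have h1'' : ‖∫ s : UnitAddCircle, kψ (k 1) s * g0 (k 1) ((t : UnitAddCircle) + s)‖ ≤
            2 * ∫ s in {s : UnitAddCircle | Id / 2 ≤ ‖s‖}, ‖kψ (k 1) s‖ := by simpa only [hkψ] using h1
        linarith
      -- second piece
      set η : ℝ := 2 * π * |((k 1 * G : ℤ) : ℝ)| * (Real.exp (-(M ^ 2 / 2)) / (2 * P.N j)) with hη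
      have hη0 : 0 ≤ η := by positivity
      have hh : Continuous fun s : UnitAddCircle => twist Ψ (k 1) ((t : UnitAddCircle) + s) - g0 (k 1) ((t : UnitAddCircle) + s) :=
        ((continuous_twist Ψ _).comp (continuous_const_add _)).sub ((hg0c _).comp (continuous_const_add _))
      have hnear : ∀ s : UnitAddCircle, ‖s‖ < Id / 2 →
          ‖twist Ψ (k 1) ((t : UnitAddCircle) + s) - g0 (k 1) ((t : UnitAddCircle) + s)‖ ≤ η := by
        intro s hs
        obtain ⟨s', rfl, hs'⟩ := exists_lift_norm_eq s
        have e : ((t : ℝ) : UnitAddCircle) + ((s' : ℝ) : UnitAddCircle) = (((t + s' : ℝ)) : UnitAddCircle) := by rfl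
        rw [e]
        refine hround k hk (t + s') fun m => ?_
        have hdrop := infDist_sub_norm_le_infDist_add C ((t : ℝ) : UnitAddCircle) ((s' : ℝ) : UnitAddCircle)
        rw [e] at hdrop
        have hw : Id / 2 ≤ infDist (((t + s' : ℝ)) : UnitAddCircle) C := by rw [hs'] at hs; linarith
        have hph := phase_far_of_le_infDist hNpos hw m
        exact lt_of_lt_of_le (by nlinarith [hcore]) hph
      have hfarB : ∀ s : UnitAddCircle,
          ‖twist Ψ (k 1) ((t : UnitAddCircle) + s) - g0 (k 1) ((t : UnitAddCircle) + s)‖ ≤ 2 := fun s => by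
        refine (norm_sub_le _ _).trans ?_
        have := hg01 (k 1) ((t : UnitAddCircle) + s)
        have := htw1 (k 1) ((t : UnitAddCircle) + s)
        linarith
      have h2 := norm_integral_mul_le_of_near_far (hkψc (k 1)) hh hη0 (by norm_num : (0 : ℝ) ≤ 2) hnear hfarB
      have h2' : ‖∫ s : UnitAddCircle, kψ (k 1) s *
          (twist Ψ (k 1) ((t : UnitAddCircle) + s) - g0 (k 1) ((t : UnitAddCircle) + s))‖ ≤ η * A + 2 * (τ / (Id / 2)) := by
        refine h2.trans (add_le_add (mul_le_mul_of_nonneg_left hkψ1 hη0) ?_)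
        exact mul_le_mul_of_nonneg_left htail (by norm_num)
      -- the decomposition
      have hdec : gmid (k 1) ((t : ℝ) : UnitAddCircle) =
          (∫ s : UnitAddCircle, kψ (k 1) s * g0 (k 1) ((t : UnitAddCircle) + s)) +
            ∫ s : UnitAddCircle, kψ (k 1) s *
              (twist Ψ (k 1) ((t : UnitAddCircle) + s) - g0 (k 1) ((t : UnitAddCircle) + s)) := by
        have hIa : Integrable fun s : UnitAddCircle => kψ (k 1) s * g0 (k 1) ((t : UnitAddCircle) + s) :=
          hI ((hkψc _).mul ((hg0c _).comp (continuous_const_add _)))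
        have hIb : Integrable fun s : UnitAddCircle => kψ (k 1) s *
            (twist Ψ (k 1) ((t : UnitAddCircle) + s) - g0 (k 1) ((t : UnitAddCircle) + s)) := hI ((hkψc _).mul hh)
        simp only [hgmid]
        rw [← integral_add hIa hIb]
        refine integral_congr_ae (Eventually.of_forall fun s => ?_)
        simp only
        ring
      -- compare with the envelope off the core
      have hkε := hε k hk
      simp only [hρ]
      rw [hρoff _ hcore.le, hdec]
      refine (norm_add_le _ _).trans ?_
      have hmain : 2 * (τ / (Id / 2)) + 2 * (τ / (Id / 2)) ≤ A * d₀ / Id := by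
        rw [show 2 * (τ / (Id / 2)) + 2 * (τ / (Id / 2)) = 8 * τ / Id by field_simp; ring]
        exact div_le_div_of_nonneg_right hAd hdpos.le
      have hηε : η * A ≤ ε₀ := by rw [mul_comm]; exact hkε
      linarith [h1', h2', hmain, hηε]
  -- the window lemma
  have hmain := sum_window_sq_norm_comp_shearMap_le_fibre hTc hTs hθ₂c h10 Ψ W gmid grest hgmidc hgrestc hsplit hsep hρc hρ0 hbd
  rw [hsum] at hmain
  refine hmain.trans (pow_le_pow_left₀ (by positivity) (add_le_add ?_ le_rfl) 2)
  -- the zone term: kernel `L¹` norm × envelope amplitude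
  have hZ : ∫ x : UnitAddTorus (Fin 2), ρ (x 0) ^ 2 * ‖T x‖ ^ 2 ≤
      (∫ s : UnitAddCircle, ‖∑ l ∈ Sχ, χ l * fourier (-l) s‖) ^ 2 * 1 ^ 2 * ∫ bb : UnitAddCircle, ρ bb ^ 2 :=
    integral_weight_mul_norm_axisCutoff_sq_le hb hb1 0 χ Sχ hρc
  have hK0 : 0 ≤ ∫ s : UnitAddCircle, ‖∑ l ∈ Sχ, χ l * fourier (-l) s‖ := integral_nonneg fun s => norm_nonneg _
  have hS0 : 0 ≤ ε₀ + A * Real.sqrt ((2 * P.N j : ℕ) * (4 * d₀)) := by positivity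
  have hρ2 : ∫ bb : UnitAddCircle, ρ bb ^ 2 ≤ (ε₀ + A * Real.sqrt ((2 * P.N j : ℕ) * (4 * d₀))) ^ 2 := by
    have h := integral_envelope_sq_le_sq CF hCFne hε0 hA0 hd₀
    refine h.trans (pow_le_pow_left₀ (by positivity) (add_le_add le_rfl (mul_le_mul_of_nonneg_left
      (Real.sqrt_le_sqrt (mul_le_mul_of_nonneg_right hCFcard (by positivity))) hA0)) 2)
  calc Real.sqrt (∫ x : UnitAddTorus (Fin 2), ρ (x 0) ^ 2 * ‖T x‖ ^ 2)
      ≤ Real.sqrt (((∫ s : UnitAddCircle, ‖∑ l ∈ Sχ, χ l * fourier (-l) s‖) *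
          (ε₀ + A * Real.sqrt ((2 * P.N j : ℕ) * (4 * d₀)))) ^ 2) := by
        refine Real.sqrt_le_sqrt (hZ.trans ?_)
        rw [one_pow, mul_one, mul_pow]
        exact mul_le_mul_of_nonneg_left hρ2 (sq_nonneg _)
    _ = (∫ s : UnitAddCircle, ‖∑ l ∈ Sχ, χ l * fourier (-l) s‖) *
          (ε₀ + A * Real.sqrt ((2 * P.N j : ℕ) * (4 * d₀))) := Real.sqrt_sq (mul_nonneg hK0 hS0)

end Summit.AnomalousDissipation.AnomalousDissipation.Theorems.SawtoothPulseCascade.K1Window
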